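import Summits.AtomisticToContinuum.HydrodynamicLimit.Theses.InformationPercolationEngine

/-!
# Negative-lane helper for crux `PercolationClosesChaos` (stmt-AtomisticToContinuum-14915, rev 4):
the sub-cell co-location excess is one-signed (the fixed-`r` floor of the kick antecedent)

Finite shadow behind finding F13 of the standing disproof record (`Cruxes/PercolationClosesChaos/Disproof.lean`,
cycle 4, §2) of the crux `PercolationClosesChaos : KickFairRelEquilibrium → SpectralContractionR → ContactChaos`
(route InformationPercolationEngine). The rev-4 antecedent `KickFairRelEquilibrium` (stmt-AtomisticToContinuum-14914)
compensates each kick test by its conditional mean `κ` under the INVARIANT law `G` given the coarse past (cells of size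
`r` + exact velocities). `G | past` is uniform inside every cell, whereas the evolved local Gibbs law carries the smooth
sub-cell local-equilibrium profile; third-body (shield / ring) events at the collision scale `ε ≪ r` are CO-LOCATION
events of two sub-cell positions, so their conditional odds under the two laws differ by the co-location excess of the
sub-cell profile (Cruxes/KickFairRelEquilibrium/Analysis-r1-k1.md §F3: `1 + (r²/6)|∇ log ρ|² + O(r³)` for a density
gradient). The lemmas below are the discrete form of "that excess is `≥ 0`, and `= 0` only for a constant profile":
with sub-cell weights `a_i` on `n` sub-boxes, two independent `a`-distributed points share a sub-box with probability
`Σ a_i² / (Σ a_i)² ≥ 1/n` (the uniform value), strictly unless `a` is constant — so the fixed-`r` defect cannot cancel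
on average over cells, which is why the decl's quantifier order `∀ r ∀ δ ∃ N₀` (instead of the target's
`∀ δ ∃ r₀ ∀ r < r₀ ∃ N₀`) is plausibly fatal and the crux plausibly vacuous (Disproof.lean
`crux_of_not_kickFairRelEquilibrium`). No statement of the route is asserted here, positively or negatively.
-/

namespace Summit.AtomisticToContinuum.HydrodynamicLimit.Theorems.PercolationClosesChaos.Negative

open scoped BigOperators

/-- Co-location excess, weak form (Cauchy–Schwarz): `(Σ a)² ≤ n · Σ a²` — two independent draws from ANY sub-cell
profile coincide at least as often as two uniform draws. [folklore] -/
theorem colocation_excess {n : ℕ} (a : Fin n → ℝ) : (∑ i, a i) ^ 2 ≤ n * ∑ i, a i ^ 2 := by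
  have := sq_sum_le_card_mul_sum_sq (s := Finset.univ) (f := a)
  simpa using this

/-- Lagrange's identity behind the strict case: `n Σ a² − (Σ a)² = ½ Σᵢ Σⱼ (aᵢ − aⱼ)²`. [folklore] -/
theorem lagrange_identity {n : ℕ} (a : Fin n → ℝ) :
    (n : ℝ) * ∑ i, a i ^ 2 - (∑ i, a i) ^ 2 = (1 / 2) * ∑ i, ∑ j, (a i - a j) ^ 2 := by
  have h1 : ∑ i, ∑ j, (a i - a j) ^ 2 = ∑ i, ∑ j, (a i ^ 2 + a j ^ 2 - 2 * (a i * a j)) := by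
    refine Finset.sum_congr rfl fun i _ => Finset.sum_congr rfl fun j _ => ?_; ring
  rw [h1]
  simp only [Finset.sum_sub_distrib, Finset.sum_add_distrib, Finset.sum_const, Finset.card_univ, Fintype.card_fin,
    nsmul_eq_mul, ← Finset.mul_sum, ← Finset.sum_mul]
  rw [sq, Finset.sum_mul_sum]
  simp only [← Finset.mul_sum]
  ring

/-- **Co-location excess, strict form**: `(Σ a)² < n · Σ a²` as soon as the sub-cell profile is not constant — the
fixed-`r` floor is one-signed and vanishes only for a locally homogeneous law. [folklore] -/
theorem colocation_excess_strict {n : ℕ} (a : Fin n → ℝ) {i j : Fin n} (hij : a i ≠ a j) :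
    (∑ i, a i) ^ 2 < n * ∑ i, a i ^ 2 := by
  have hL := lagrange_identity a
  have hpos : 0 < ∑ i, ∑ j, (a i - a j) ^ 2 := by
    have hle : (a i - a j) ^ 2 ≤ ∑ j', (a i - a j') ^ 2 :=
      Finset.single_le_sum (f := fun j' => (a i - a j') ^ 2) (fun _ _ => sq_nonneg _) (Finset.mem_univ j)
    have hle2 : ∑ j', (a i - a j') ^ 2 ≤ ∑ i', ∑ j', (a i' - a j') ^ 2 :=
      Finset.single_le_sum (f := fun i' => ∑ j', (a i' - a j') ^ 2)
        (fun _ _ => Finset.sum_nonneg fun _ _ => sq_nonneg _) (Finset.mem_univ i)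
    have hsq : 0 < (a i - a j) ^ 2 := by
      have : a i - a j ≠ 0 := sub_ne_zero.2 hij
      positivity
    linarith
  linarith

end Summit.AtomisticToContinuum.HydrodynamicLimit.Theorems.PercolationClosesChaos.Negative
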